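import Literature.MathematicalPhysics.QuantumFieldTheory.Balaban1983to89.B6Ineq2134TransposeDiag

/-!
# `Balaban1983to89.B6Ineq2134TransposeLeftFactor` — T. Bałaban, *Propagators and renormalization transformations for lattice gauge theories. II*,
# Commun. Math. Phys. **96** (1984) 223–250 [Balaban1984PropagatorsII], (2.134) p. 247 FOR THE REVERSED KERNELS `h_{□′}G_{□′}K̃_{□,□′}` WITH AN
# ARBITRARY LEFT FACTOR IN FRONT OF `h_{□′}G_{□′}` — the input the HÖLDER member (2.137)₂ `‖ζG∇*J‖_α` of Prop. 2.6 needs from the transposed walk: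
# p38 gen 31's `…B6Ineq2134TransposeDiag` (lines 1–4 of (2.92) and (2.93) read from the right) with the product `h_{□′}G_{□′}` abstracted to any operator
# `Lft` carrying majorants of the (2.133) shapes

statement-level skeleton of published theorems with citation tags; proofs where landed; nothing here is a claim about the Yang–Mills mass gap

PDF held: `paper:balaban1984-cmp96-propagators-rt-ii` (journal page = PDF page + 222); p. 247 [PDF 25] ((2.133)–(2.137), (2.141)) re-read this generation on
the ×2 render `b2b-balaban-ref1/pages/1984-cmp96-propagators-rt-II/1984-cmp96-propagators-rt-II-p025-x2.png`: *"‖ζ∇GJ‖_α, ‖ζG∇*J‖_α ≤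
O(1)(Lʲη)^{1−α}(‖ζ‖_α^ξ + |ζ|)e^{−δ₃d(y,y′)}|J|, ξ = L^{−j} (2.137) … G = G₀(I − R)⁻¹ = Σ_{n=0}^∞ G₀Rⁿ = Σ_ω h_{□₀}G_{□₀}h_{□₀}K_{□₁,□₂}G_{□₂}h_{□₂}⋯ (2.141)
and the series above is convergent in the norms appearing in the inequalities (2.136)–(2.140)."*; p. 239 [PDF 17] ((2.91)–(2.93)); p. 234 [PDF 12]
(Lemma 2.1, and Prop. 2.2 (2.67): *"‖ζ∇^η_xG′λ‖_α, ‖ζG′∇^{η*}λ‖_α ≤ O(1)(Lʲη)^{1−α}(‖ζ‖_α + |ζ|)e^{−½δ₀d(y,y′)}|λ|"* — the scalar precedent).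

CITATION HEADER (lean-in-tree rule) — WHAT IS REPRODUCED.  Phase-2 file of the `lit-balaban` typed skeleton (HOME `run/shared/lean/pub/lit-balaban/`), seat
**p38 gen 32**, brick 1 of the programme «(2.137)₂ `‖ζG∇*J‖_α` at k levels by the transposed walk» (HOME/STATUS.md 2026-08-23T22:54Z; fold owner r03,
neighbour p22 — whose (2.137)₁ lane is untouched); SKELETON rows **B6.Eq2.134** × B6.Eq2.92 × B6.Eq2.93 × B6.Prop2.6 (cells only; decls of record untouched).
THE READING.  For the second Hölder member of (2.137) the norm is taken on the OUTPUT side of a RIGHT-factor entry `G∇*`; by the transposed fixed point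
`G = G₀ + R̃G` (p38's `…B6Eq291Transpose.leftFixedPointT`) one has, for any left factor `P` (the Hölder pair difference `P_{x,x′}` of [4] (1.109)),
`P·G·∇* = P·G₀·∇* + (P·R̃)·(G∇*)`, `R̃ = Σ h_{□′}G_{□′}K̃_{□,□′}` — so (2.134) is needed for the kernels `P·h_{□′}G_{□′}K̃_{□,□′}` with `P` IN FRONT.  Every line
bound of `…B6Ineq2134TransposeDiag` used only majorants of the product `h_{□′}G_{□′}` (and of `h_{□′}G_{□′}E_i`) of the (2.133) shapes `C·(Lʲη)²e^{−δ₂d}`;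
THIS FILE restates those bounds for an ARBITRARY operator `Lft` in place of `h_{□′}G_{□′}` under the same majorant shapes (its output localisation
`OutLoc Lft U` replacing `supp h_{□′} ⊂ U`):
* §1 **`hasMajorant_mul_mulOp_weight`** (a global majorant `K` of `T` and a right factor `|c(x′)| ≤ α(y′)` supported over `S` give `1_S(y′)·K·α(y′)` for `T·c`),
  **`termL_hasMajorant`** (one input-weighted term with the scale ratio read in the opposite orientation, `ratio_exp_le`),
  **`line1L_hasMajorant`** — line 1 of (2.92) from the right behind `Lft`: `Lft·(Σ_i E_i·c_i − c₀)` has the majorant `1_S(y′)·((#D·s₁C₁ + s₂C_L)L²/M)·e^{−⅞δ₂d}`;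
* §2 **`diagL_hasMajorant`** — the whole reversed diagonal kernel behind `Lft`,
  `Lft·((((Σ_iE_ic_i − c₀) + Σ_k(h_□N_k − N_kh_□)z_k) + D₃ᵀ) + (h_□P_□ − P_□h_□)ζ_□)`: majorant `θ_diagᴸ·e^{−½δ₂d}` with
  `θ_diagᴸ = (#D·s₁C₁ + s₂C_L)L²/M + (#K + 1)(s/M)C_NC_LL²(8/δ₂ + r₀)c² + C_De^{−c_DM}C_LL²c²` (lines 2, 4 by `commLineT_hasMajorant_rightCut`, line 3 by
  `domLineT_hasMajorant`, both already generic in the left factor), and **`compactL_inLoc`** (input localisation of the compact form behind `Lft`);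
* §3 **`offDiagL_hasMajorant_ind`** — (2.93) from the right behind `Lft`: `Lft·(h_{□′}∂P∂*(1 − ζ_{□′}))·h_□²` has the majorant
  `1_{U′}(y)1_U(y′)·C_PC_LL²c²e^{−⅛δ₂mM}·e^{−½δ₂d}` (`offDiagT_hasMajorant` + `hasMajorant_localise`).
THEOREMS ONLY (no `def`, no `def … : Prop`, no new hypothesis-shaped fact); imports `…B6Ineq2134TransposeDiag` and uses it BY NAME; standard axioms.

HONEST SCOPE / DIVERGENCES.  (1) Pure bookkeeping over an abstract block geometry: nothing is proved about any operator of the paper; the instance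
`Lft = P_{x,x′}·h_{□′}G_{□′}` (whose majorants are LIPSCHITZ pair legs of `G_{□′}`, i.e. the (1.110)₂-type sup bounds of `∇G_{□′}` telescoped) is supplied on
the V1 torus downstream.  (2) As the imported file: Lemma 2.1 in the repaired form `Ineq263With c`, level separation `LevelSep` with `L² ≤ e^{⅛δ₂RM}`,
rates `⅞δ₂`, `½δ₂`, the extra `L²` of the opposite orientation; the majorants of `Lft`, `Lft·E_i` are GLOBAL hypotheses (for the intended instance the
output is one fine bond, so global = local).  (3) Print does not spell the two-sided walk for (2.137)₂ out (*"reasoning in the same way as in the proof of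
Proposition 2.2"*); the one-step identity above is OURS, recorded in HOME/GAPS.md with the programme.  Nothing on d = 4 or the continuum; NOT summit
progress.  Unit `lit-balaban-p38` (gen 32), 2026-08-23.
-/

namespace Literature.MathematicalPhysics.QuantumFieldTheory.Balaban1983to89.B6Ineq2134TransposeLeftFactor

open B6RandomWalk B6Prop26Gluing Finset
open B6Ineq268 (LevelSep)
open B6Lemma21Repaired (Ineq263With)
open B6InMajorantTransplant (InMajorant)
open B6Ineq2134TransposeDiag (ratio_exp_le commLineT_hasMajorant_rightCut domLineT_hasMajorant offDiagT_hasMajorant)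

variable {g : B6.Geometry} {X : Type}

/-! ## §1  Line 1 of (2.92) read from the right behind an arbitrary left factor -/

section LineOne

/-- majorants pass to `−T`. [cite: Balaban1984PropagatorsII, (2.51) p.232, bookkeeping] -/
private theorem hasMajorant_neg' (blk : X → g.Site) {T : Module.End ℝ (X → ℝ)} {K : g.Site → g.Site → ℝ}
    (hT : HasMajorant blk T K) : HasMajorant blk (-T) K := by
  intro y' μ B hμ x
  rw [LinearMap.neg_apply, Pi.neg_apply, abs_neg]
  exact hT y' μ B hμ x

/-- **A WEIGHTED RIGHT FACTOR** (the mirror of r03's `hasMajorant_sandwichW` with NO left cut-off): a global majorant `K ≥ 0` of `T` and a right factor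
`c` with `|c(x′)| ≤ α(y(x′))` (`α ≥ 0`) supported over the blocks of `S` give the majorant `1_S(y′)·K(y,y′)·α(y′)` of `T·c` — the weight is read at the
INPUT block. [cite: Balaban1984PropagatorsII, (2.92) p.239 (the coefficients of `[Δ, h_□]`) + (2.51) p.232] -/
theorem hasMajorant_mul_mulOp_weight (blk : X → g.Site) {T : Module.End ℝ (X → ℝ)} {c : X → ℝ} {S : Set g.Site}
    {K : g.Site → g.Site → ℝ} {α : g.Site → ℝ} (hK : ∀ y y', 0 ≤ K y y') (hα : ∀ y, 0 ≤ α y)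
    (hT : HasMajorant blk T K) (hcS : ∀ x, c x ≠ 0 → blk x ∈ S) (hc : ∀ x, |c x| ≤ α (blk x)) :
    HasMajorant blk (T * mulOp c) (fun y y' => ind S y' * (K y y' * α y')) := by
  intro y' μ B hμ x
  beta_reduce
  rw [Module.End.mul_apply]
  by_cases hy : y' ∈ S
  · have hcμ : BlockSupp blk (mulOp c μ) y' (α y' * B) := by
      refine ⟨mul_nonneg (hα _) hμ.nonneg, fun x' hx' => ?_, fun x' hx' => ?_⟩
      · rw [mulOp_apply, abs_mul, ← hx']
        exact mul_le_mul (hc x') (hμ.bound x' hx') (abs_nonneg _) (hα _)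
      · rw [mulOp_apply, hμ.off x' hx', mul_zero]
    rw [ind_of_mem hy, one_mul]
    calc |T (mulOp c μ) x| ≤ K (blk x) y' * (α y' * B) := hT y' (mulOp c μ) (α y' * B) hcμ x
      _ = K (blk x) y' * α y' * B := by ring
  · rw [mulOp_eq_zero_of_blockSupp blk hcS hμ hy, map_zero, Pi.zero_apply, abs_zero]
    exact mul_nonneg (mul_nonneg (ind_nonneg _ _) (mul_nonneg (hK _ _) (hα _))) hμ.nonneg

/-- **ONE INPUT-WEIGHTED TERM BEHIND A LEFT FACTOR**: `T·c` with `T` under the global majorant `C_K(Lʲη)²e^{−δ₂d}` and `|c(x′)| ≤ s/(M(L^{j′}η)²)` supported over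
`S` has the majorant `1_S(y′)·(s·C_K·L²/M)·e^{−⅞δ₂d}` (the scale ratio between the two ends absorbed by `ratio_exp_le`).
[cite: Balaban1984PropagatorsII, (2.134) p.247 + (2.92) p.239 + Lemma 2.1 (2.60) p.234] -/
theorem termL_hasMajorant (blk : X → g.Site) (hL : 1 ≤ g.L) (hη : 0 < g.eta) (hsep : LevelSep g) (hM : 0 < g.M)
    {δ₂ CK s : ℝ} (hδ₂ : 0 ≤ δ₂) (hCK : 0 ≤ CK) (hs : 0 ≤ s) (hRM : 0 ≤ g.R * g.M) (hthr : g.L ^ 2 ≤ Real.exp (1 / 8 * δ₂ * (g.R * g.M)))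
    {T : Module.End ℝ (X → ℝ)} {c : X → ℝ} {S : Set g.Site}
    (hT : HasMajorant blk T fun y y' => CK * g.len y ^ 2 * Real.exp (-(δ₂ * g.dist y y')))
    (hc : ∀ x, |c x| ≤ s / (g.M * g.len (blk x) ^ 2)) (hcS : ∀ x, c x ≠ 0 → blk x ∈ S) :
    HasMajorant blk (T * mulOp c) fun y y' => ind S y' * (s * CK * g.L ^ 2 / g.M * Real.exp (-(7 / 8 * δ₂ * g.dist y y'))) := by
  have hL0 : 0 < g.L := zero_lt_one.trans_le hL
  have hlen : ∀ z : g.Site, 0 < g.len z := fun z => mul_pos (pow_pos hL0 _) hη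
  have hK : ∀ y y' : g.Site, 0 ≤ CK * g.len y ^ 2 * Real.exp (-(δ₂ * g.dist y y')) := fun y y' => by positivity
  have hα : ∀ y : g.Site, 0 ≤ s / (g.M * g.len y ^ 2) := fun y => by have := hlen y; positivity
  refine hasMajorant_mono blk (hasMajorant_mul_mulOp_weight blk hK hα hT hcS hc) fun y y' => ?_
  refine mul_le_mul_of_nonneg_left ?_ (ind_nonneg _ _)
  have hr := ratio_exp_le hL hη hsep hδ₂ hRM hthr y y'
  have hl := hlen y'
  have hM0 := hM
  calc CK * g.len y ^ 2 * Real.exp (-(δ₂ * g.dist y y')) * (s / (g.M * g.len y' ^ 2))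
      = s * CK / g.M * (g.len y ^ 2 / g.len y' ^ 2 * Real.exp (-(δ₂ * g.dist y y'))) := by
        field_simp
    _ ≤ s * CK / g.M * (g.L ^ 2 * Real.exp (-(7 / 8 * δ₂ * g.dist y y'))) := mul_le_mul_of_nonneg_left hr (by positivity)
    _ = _ := by ring

/-- **LINE 1 OF (2.92) READ FROM THE RIGHT BEHIND AN ARBITRARY LEFT FACTOR** — `Lft·(Σ_i E_i·c_i − c₀)`: with `Lft·E_i` and `Lft` under the GLOBAL majorants
`C₁(Lʲη)²e^{−δ₂d}`, `C_L(Lʲη)²e^{−δ₂d}` ((2.133) shapes), coefficients `|c_i(x′)| ≤ s₁/(M(L^{j′}η)²)`, `|c₀(x′)| ≤ s₂/(M(L^{j′}η)²)` supported over `S`: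
majorant `1_S(y′)·((#D·s₁C₁ + s₂C_L)L²/M)·e^{−⅞δ₂d}`. [cite: Balaban1984PropagatorsII, (2.134) p.247 + (2.92) p.239 (line 1) + (2.133) p.247] -/
theorem line1L_hasMajorant (blk : X → g.Site) (hL : 1 ≤ g.L) (hη : 0 < g.eta) (hsep : LevelSep g) (hM : 0 < g.M)
    {δ₂ CL C₁ s₁ s₂ : ℝ} (hδ₂ : 0 ≤ δ₂) (hCL : 0 ≤ CL) (hC₁ : 0 ≤ C₁) (hs₁ : 0 ≤ s₁) (hs₂ : 0 ≤ s₂)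
    (hRM : 0 ≤ g.R * g.M) (hthr : g.L ^ 2 ≤ Real.exp (1 / 8 * δ₂ * (g.R * g.M)))
    {ι : Type} (D : Finset ι) {E : ι → Module.End ℝ (X → ℝ)} {c : ι → X → ℝ} {c₀ : X → ℝ}
    {Lft : Module.End ℝ (X → ℝ)} {S : Set g.Site}
    (hLf : HasMajorant blk Lft fun y y' => CL * g.len y ^ 2 * Real.exp (-(δ₂ * g.dist y y')))
    (hLE : ∀ i ∈ D, HasMajorant blk (Lft * E i) fun y y' => C₁ * g.len y ^ 2 * Real.exp (-(δ₂ * g.dist y y')))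
    (hc : ∀ i ∈ D, ∀ x, |c i x| ≤ s₁ / (g.M * g.len (blk x) ^ 2)) (hcS : ∀ i ∈ D, ∀ x, c i x ≠ 0 → blk x ∈ S)
    (hc₀ : ∀ x, |c₀ x| ≤ s₂ / (g.M * g.len (blk x) ^ 2)) (hc₀S : ∀ x, c₀ x ≠ 0 → blk x ∈ S) :
    HasMajorant blk (Lft * (∑ i ∈ D, E i * mulOp (c i) - mulOp c₀)) fun y y' =>
      ind S y' * ((((D.card : ℝ) * (s₁ * C₁) + s₂ * CL) * g.L ^ 2 / g.M) * Real.exp (-(7 / 8 * δ₂ * g.dist y y'))) := by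
  classical
  have e : Lft * (∑ i ∈ D, E i * mulOp (c i) - mulOp c₀) = ∑ i ∈ D, Lft * E i * mulOp (c i) + -(Lft * mulOp c₀) := by
    rw [mul_sub, Finset.mul_sum, sub_eq_add_neg]
    simp only [mul_assoc]
  rw [e]
  have h1 : ∀ i ∈ D, HasMajorant blk (Lft * E i * mulOp (c i))
      (fun y y' => ind S y' * (s₁ * C₁ * g.L ^ 2 / g.M * Real.exp (-(7 / 8 * δ₂ * g.dist y y')))) := fun i hi =>
    termL_hasMajorant blk hL hη hsep hM hδ₂ hC₁ hs₁ hRM hthr (hLE i hi) (hc i hi) (hcS i hi)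
  have h0 := hasMajorant_neg' blk (termL_hasMajorant blk hL hη hsep hM hδ₂ hCL hs₂ hRM hthr hLf hc₀ hc₀S)
  refine hasMajorant_mono blk (hasMajorant_add blk (hasMajorant_finsetSum blk D _ _ h1) h0) fun y y' => ?_
  rw [Finset.sum_const, nsmul_eq_mul]
  exact le_of_eq (by ring)

end LineOne

/-! ## §2  The whole reversed diagonal kernel behind an arbitrary left factor -/

section Diagonal

/-- input localisation is additive. [cite: Balaban1984PropagatorsII, (2.91) p.239, bookkeeping] -/
private theorem inLoc_add (blk : X → g.Site) {T T' : Module.End ℝ (X → ℝ)} {U : Set g.Site} (hT : InLoc blk T U) (hT' : InLoc blk T' U) :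
    InLoc blk (T + T') U := by
  intro y' μ B hμ hy'
  rw [LinearMap.add_apply, hT y' μ B hμ hy', hT' y' μ B hμ hy', add_zero]

/-- input localisation is subtractive. [cite: Balaban1984PropagatorsII, (2.91) p.239, bookkeeping] -/
private theorem inLoc_sub (blk : X → g.Site) {T T' : Module.End ℝ (X → ℝ)} {U : Set g.Site} (hT : InLoc blk T U) (hT' : InLoc blk T' U) :
    InLoc blk (T - T') U := by
  intro y' μ B hμ hy'
  rw [LinearMap.sub_apply, hT y' μ B hμ hy', hT' y' μ B hμ hy', sub_zero]

/-- **INPUT LOCALISATION OF THE COMPACT REVERSED DIAGONAL TERM BEHIND A LEFT FACTOR** `Lft·((M_□h_□ − h_□M_□) + h_□(∂P∂* − P_□)ζ_□ + (h_□P_□ − P_□h_□)ζ_□)`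
over `U`: `supp h_□ ⊂ U`, the inputs of `h_□M_□` over `U`, `supp ζ_□ ⊂ U` (the left factor is irrelevant).
[cite: Balaban1984PropagatorsII, (2.91)–(2.92) p.239 (supp h_□, supp ζ_□ ⊂ □̃, range of Δ)] -/
theorem compactL_inLoc (blk : X → g.Site) (Lft : Module.End ℝ (X → ℝ)) {Ml Dg Pl : Module.End ℝ (X → ℝ)} {hI ζ : X → ℝ} {U : Set g.Site}
    (hIU : ∀ x, hI x ≠ 0 → blk x ∈ U) (hMin : InLoc blk (mulOp hI * Ml) U) (hζU : ∀ x, ζ x ≠ 0 → blk x ∈ U) :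
    InLoc blk (Lft * ((Ml * mulOp hI - mulOp hI * Ml) + mulOp hI * (Dg - Pl) * mulOp ζ + (mulOp hI * Pl - Pl * mulOp hI) * mulOp ζ)) U :=
  inLoc_mul blk _ (inLoc_add blk (inLoc_add blk (inLoc_sub blk (inLoc_mul_mulOp blk _ hIU) hMin) (inLoc_mul_mulOp blk _ hζU))
    (inLoc_mul_mulOp blk _ hζU))

/-- **(2.134), DIAGONAL PAIRS, READ FROM THE RIGHT BEHIND AN ARBITRARY LEFT FACTOR** — `Lft·K̃_{□,□}` in the decomposed form
`Lft·((((Σ_iE_ic_i − c₀) + Σ_k(h_□N_k − N_kh_□)z_k) + D₃ᵀ) + (h_□P_□ − P_□h_□)ζ_□)` with `Lft`, `Lft·E_i` under the GLOBAL majorants `C_L(Lʲη)²e^{−δ₂d}`,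
`C₁(Lʲη)²e^{−δ₂d}`, the coefficients read at the input bond, `h_□` block-Lipschitz `(s/M)(d + r₀)` and supported over `T`, the partners `N_k`, `P_□` In- and Out-
localised over `T` with `C_N(Lʲη)^{−2}e^{−δ₂d}`, `|z_k|, |ζ_□| ≤ 1`, `D₃ᵀ` under `C_De^{−c_DM}(L^{j″}η)^{−2}e^{−δ₂d}`: majorant `θ_diagᴸ·e^{−½δ₂d}`,
`θ_diagᴸ = (#D·s₁C₁ + s₂C_L)L²/M + (#K + 1)·(s/M)·C_NC_LL²(8/δ₂ + r₀)c² + C_De^{−c_DM}C_LL²c²`.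
[cite: Balaban1984PropagatorsII, (2.134) p.247 + (2.92) p.239 + (2.133) p.247 + Lemma 2.1 (2.60), (2.63) p.234] -/
theorem diagL_hasMajorant (blk : X → g.Site) (hL : 1 ≤ g.L) (hη : 0 < g.eta) (hsep : LevelSep g)
    (hd : ∀ a b, 0 ≤ g.dist a b) {δ₂ CL C₁ CN CD cD c s s₁ s₂ r₀ : ℝ} (hδ₂ : 0 < δ₂) (hCL : 0 ≤ CL)
    (hC₁ : 0 ≤ C₁) (hCN : 0 ≤ CN) (hCD : 0 ≤ CD) (hs : 0 ≤ s) (hs₁ : 0 ≤ s₁) (hs₂ : 0 ≤ s₂) (hr₀ : 0 ≤ r₀)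
    (hM : 0 < g.M) (hRM : 0 ≤ g.R * g.M) (hthr : g.L ^ 2 ≤ Real.exp (1 / 8 * δ₂ * (g.R * g.M)))
    (h263 : Ineq263With c g (3 / 4 * δ₂) (1 / 3))
    {Lft Pl D₃ : Module.End ℝ (X → ℝ)} {hI c₀ ζ : X → ℝ} {S T : Set g.Site}
    {ι : Type} (D : Finset ι) {E : ι → Module.End ℝ (X → ℝ)} {cf : ι → X → ℝ}
    {κ : Type} (DK : Finset κ) {N : κ → Module.End ℝ (X → ℝ)} {z : κ → X → ℝ}
    (hLf : HasMajorant blk Lft fun y y'' => CL * g.len y ^ 2 * Real.exp (-(δ₂ * g.dist y y'')))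
    (hLE : ∀ i ∈ D, HasMajorant blk (Lft * E i) fun y y' => C₁ * g.len y ^ 2 * Real.exp (-(δ₂ * g.dist y y')))
    (hc : ∀ i ∈ D, ∀ x, |cf i x| ≤ s₁ / (g.M * g.len (blk x) ^ 2)) (hcS : ∀ i ∈ D, ∀ x, cf i x ≠ 0 → blk x ∈ S)
    (hc₀ : ∀ x, |c₀ x| ≤ s₂ / (g.M * g.len (blk x) ^ 2)) (hc₀S : ∀ x, c₀ x ≠ 0 → blk x ∈ S)
    (hIT : ∀ x, hI x ≠ 0 → blk x ∈ T)
    (hLip : ∀ x x', |hI x' - hI x| ≤ s / g.M * (g.dist (blk x) (blk x') + r₀))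
    (hNin : ∀ k ∈ DK, InMajorant blk (N k) T fun y y'' => CN / g.len y ^ 2 * Real.exp (-(δ₂ * g.dist y y'')))
    (hNout : ∀ k ∈ DK, ∀ (y'' : g.Site) (μ : X → ℝ) (B : ℝ), BlockSupp blk μ y'' B → ∀ x, blk x ∈ T →
      |N k μ x| ≤ CN / g.len (blk x) ^ 2 * Real.exp (-(δ₂ * g.dist (blk x) y'')) * B)
    (hz : ∀ k ∈ DK, ∀ x, |z k x| ≤ 1)
    (hPlin : InMajorant blk Pl T fun y y'' => CN / g.len y ^ 2 * Real.exp (-(δ₂ * g.dist y y'')))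
    (hPlout : ∀ (y'' : g.Site) (μ : X → ℝ) (B : ℝ), BlockSupp blk μ y'' B → ∀ x, blk x ∈ T →
      |Pl μ x| ≤ CN / g.len (blk x) ^ 2 * Real.exp (-(δ₂ * g.dist (blk x) y'')) * B)
    (hζ : ∀ x, |ζ x| ≤ 1)
    (hD : HasMajorant blk D₃ fun y'' y' => CD * Real.exp (-(cD * g.M)) / g.len y'' ^ 2 * Real.exp (-(δ₂ * g.dist y'' y'))) :
    HasMajorant blk
      (Lft * ((((∑ i ∈ D, E i * mulOp (cf i) - mulOp c₀) + ∑ k ∈ DK, (mulOp hI * N k - N k * mulOp hI) * mulOp (z k)) + D₃) +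
        (mulOp hI * Pl - Pl * mulOp hI) * mulOp ζ))
      fun y y' =>
        (((D.card : ℝ) * (s₁ * C₁) + s₂ * CL) * g.L ^ 2 / g.M + ((DK.card : ℝ) + 1) * (s / g.M * (CN * CL * g.L ^ 2 * (8 / δ₂ + r₀)) * c ^ 2) +
            CD * Real.exp (-(cD * g.M)) * CL * g.L ^ 2 * c ^ 2) *
          Real.exp (-(1 / 2 * δ₂ * g.dist y y')) := by
  classical
  -- distribute the left factor
  have e : Lft * ((((∑ i ∈ D, E i * mulOp (cf i) - mulOp c₀) + ∑ k ∈ DK, (mulOp hI * N k - N k * mulOp hI) * mulOp (z k)) + D₃) +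
        (mulOp hI * Pl - Pl * mulOp hI) * mulOp ζ) =
      ((Lft * (∑ i ∈ D, E i * mulOp (cf i) - mulOp c₀) +
        ∑ k ∈ DK, Lft * ((mulOp hI * N k - N k * mulOp hI) * mulOp (z k))) + Lft * D₃) +
        Lft * ((mulOp hI * Pl - Pl * mulOp hI) * mulOp ζ) := by
    rw [mul_add, mul_add, mul_add, Finset.mul_sum]
  rw [e]
  -- line 1
  have h1 := line1L_hasMajorant blk hL hη hsep hM hδ₂.le hCL hC₁ hs₁ hs₂ hRM hthr D hLf hLE hc hcS hc₀ hc₀S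
  -- lines 2 (family) and 4: r03/p38's commutator lemma, generic in the left factor
  have h2 := hasMajorant_finsetSum blk DK (fun k => Lft * ((mulOp hI * N k - N k * mulOp hI) * mulOp (z k)))
    (fun _ y y' => s / g.M * (CN * CL * g.L ^ 2 * (8 / δ₂ + r₀)) * c ^ 2 * Real.exp (-(1 / 2 * δ₂ * g.dist y y')))
    fun k hk => commLineT_hasMajorant_rightCut blk hL hη hsep hd hδ₂ hCN hCL hs hr₀ hM hRM hthr h263 (hNin k hk) (hNout k hk) (hz k hk) hIT hLip hLf
  have h4 := commLineT_hasMajorant_rightCut blk hL hη hsep hd hδ₂ hCN hCL hs hr₀ hM hRM hthr h263 hPlin hPlout hζ hIT hLip hLf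
  -- line 3
  have h3 := domLineT_hasMajorant blk hL hη hsep hd hδ₂.le hCD hCL hRM hthr h263 hD hLf
  refine hasMajorant_mono blk (hasMajorant_add blk (hasMajorant_add blk (hasMajorant_add blk h1 h2) h3) h4) fun y y' => ?_
  -- pointwise
  have hθ₁ : 0 ≤ ((D.card : ℝ) * (s₁ * C₁) + s₂ * CL) * g.L ^ 2 / g.M := by positivity
  have hrate : Real.exp (-(7 / 8 * δ₂ * g.dist y y')) ≤ Real.exp (-(1 / 2 * δ₂ * g.dist y y')) := by
    apply Real.exp_le_exp.mpr; have := hd y y'; nlinarith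
  have hl1 : ind S y' * ((((D.card : ℝ) * (s₁ * C₁) + s₂ * CL) * g.L ^ 2 / g.M) * Real.exp (-(7 / 8 * δ₂ * g.dist y y'))) ≤
      ((D.card : ℝ) * (s₁ * C₁) + s₂ * CL) * g.L ^ 2 / g.M * Real.exp (-(1 / 2 * δ₂ * g.dist y y')) := by
    calc ind S y' * ((((D.card : ℝ) * (s₁ * C₁) + s₂ * CL) * g.L ^ 2 / g.M) * Real.exp (-(7 / 8 * δ₂ * g.dist y y')))
        ≤ 1 * (((D.card : ℝ) * (s₁ * C₁) + s₂ * CL) * g.L ^ 2 / g.M * Real.exp (-(1 / 2 * δ₂ * g.dist y y'))) :=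
          mul_le_mul (ind_le_one _ _) (mul_le_mul_of_nonneg_left hrate hθ₁) (by positivity) zero_le_one
      _ = _ := one_mul _
  rw [Finset.sum_const, nsmul_eq_mul]
  have hc2 : 0 ≤ s / g.M * (CN * CL * g.L ^ 2 * (8 / δ₂ + r₀)) * c ^ 2 * Real.exp (-(1 / 2 * δ₂ * g.dist y y')) := by positivity
  nlinarith [hl1, hc2]

end Diagonal

/-! ## §3  (2.93) read from the right behind an arbitrary left factor -/

section OffDiag

/-- **(2.134), OFF-DIAGONAL PAIRS, READ FROM THE RIGHT BEHIND AN ARBITRARY LEFT FACTOR, WITH THE LOCALISATION INDICATORS** — `Lft·(h_{□′}∂P∂*(1 − ζ_{□′}))·a`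
(`a = h_□²`): with `Lft` under the global `C_L(Lʲη)²e^{−δ₂d}` and output-localised over `U_{□′}`, `∂P∂*` under `C_P(Lʲη)^{−2}e^{−δ₂d}`, `|h_{□′}| ≤ 1`
supported over `S`, `w = 1 − ζ_{□′}` vanishing on the core, `|a| ≤ 1` supported over `U_□`, and the gap `mM` read from the inside out: majorant
`1_{U′}(y)1_U(y′)·C_PC_LL²c²e^{−⅛δ₂mM}·e^{−½δ₂d}`. [cite: Balaban1984PropagatorsII, (2.134)–(2.135) p.247 + (2.93) p.239 + Lemma 2.1 (2.60), (2.63) p.234] -/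
theorem offDiagL_hasMajorant_ind (blk : X → g.Site) (hL : 1 ≤ g.L) (hη : 0 < g.eta) (hsep : LevelSep g)
    (hd : ∀ a b, 0 ≤ g.dist a b) {δ₂ CP CL c m : ℝ} (hδ₂ : 0 ≤ δ₂) (hCP : 0 ≤ CP) (hCL : 0 ≤ CL)
    (hRM : 0 ≤ g.R * g.M) (hthr : g.L ^ 2 ≤ Real.exp (1 / 8 * δ₂ * (g.R * g.M)))
    (h263 : Ineq263With c g (3 / 4 * δ₂) (1 / 3))
    {DP Lft : Module.End ℝ (X → ℝ)} {hJ w a : X → ℝ} {S Score UJ UI : Set g.Site}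
    (hP : HasMajorant blk DP fun y'' b => CP / g.len y'' ^ 2 * Real.exp (-(δ₂ * g.dist y'' b)))
    (hLf : HasMajorant blk Lft fun y y'' => CL * g.len y ^ 2 * Real.exp (-(δ₂ * g.dist y y'')))
    (hLout : OutLoc blk Lft UJ)
    (hJ1 : ∀ x, |hJ x| ≤ 1) (hJS : ∀ x, hJ x ≠ 0 → blk x ∈ S)
    (hw1 : ∀ x, |w x| ≤ 1) (hwS : ∀ x, w x ≠ 0 → blk x ∉ Score) (ha1 : ∀ x, |a x| ≤ 1) (haU : ∀ x, a x ≠ 0 → blk x ∈ UI)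
    (hgap : ∀ y'' b, y'' ∈ S → b ∉ Score → m * g.M ≤ g.dist y'' b) :
    HasMajorant blk (Lft * (mulOp hJ * DP * mulOp w) * mulOp a) fun y y' =>
      ind UJ y * ind UI y' * (CP * CL * g.L ^ 2 * c ^ 2 * Real.exp (-(1 / 8 * δ₂ * (m * g.M))) * Real.exp (-(1 / 2 * δ₂ * g.dist y y'))) := by
  have h0 := offDiagT_hasMajorant blk hL hη hsep hd hδ₂ hCP hCL hRM hthr h263 hP hLf hJ1 hJS hw1 hwS ha1 hgap
  have hK : ∀ y y' : g.Site, 0 ≤ CP * CL * g.L ^ 2 * c ^ 2 * Real.exp (-(1 / 8 * δ₂ * (m * g.M))) * Real.exp (-(1 / 2 * δ₂ * g.dist y y')) :=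
    fun y y' => by positivity
  have hout : OutLoc blk (Lft * (mulOp hJ * DP * mulOp w) * mulOp a) UJ := outLoc_mul blk (outLoc_mul blk hLout _) _
  have hin : InLoc blk (Lft * (mulOp hJ * DP * mulOp w) * mulOp a) UI := inLoc_mul_mulOp blk _ haU
  exact hasMajorant_localise blk h0 hK hout hin

/-- **THE DIAGONAL TERM BEHIND A LEFT FACTOR, WITH THE LOCALISATION INDICATORS** `1_U(y)1_U(y′)`: a majorant `K ≥ 0` of `Lft·T` with `Lft` output-localised over
`U` and `T` input-localised over `U` improves to `1_U(y)1_U(y′)·K`. [cite: Balaban1984PropagatorsII, (2.91)–(2.92) p.239, bookkeeping] -/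
theorem hasMajorant_ind_of_outLoc_inLoc (blk : X → g.Site) {Lft T : Module.End ℝ (X → ℝ)} {U : Set g.Site} {K : g.Site → g.Site → ℝ}
    (hK : ∀ y y', 0 ≤ K y y') (hLT : HasMajorant blk (Lft * T) K) (hLout : OutLoc blk Lft U) (hin : InLoc blk (Lft * T) U) :
    HasMajorant blk (Lft * T) fun y y' => ind U y * ind U y' * K y y' :=
  hasMajorant_localise blk hLT hK (outLoc_mul blk hLout T) hin

end OffDiag

end Literature.MathematicalPhysics.QuantumFieldTheory.Balaban1983to89.B6Ineq2134TransposeLeftFactor
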